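import Mathlib
import Literature.Analysis.FluidPDE.VectorCalculus
import Literature.Analysis.FluidPDE.AxisymmetricEuler
import Literature.Analysis.FluidPDE.AxisymmetricVorticityTransport
import Literature.Analysis.FluidPDE.SwirlTransportProofs
import Summits.NavierStokesRegularity.NavierStokesRegularity.Theorems.ThreadingFluxHorizonTowerDefs
import Summits.NavierStokesRegularity.NavierStokesRegularity.Theorems.ThreadingFluxPrecessionConicalEulerTools
import Summits.NavierStokesRegularity.NavierStokesRegularity.Theorems.ThreadingFluxPrecessionPrecessingHorizonZonality
import Summits.NavierStokesRegularity.NavierStokesRegularity.Theorems.ThreadingFluxSilentShellsTwoAxesTools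
import HarnessLib

/-!
# Crux `PoloidalLiouville` (stmt-NavierStokesRegularity-1222, W1), crux idea «silent-shells» (ns-idea-15 g8):
# (O2) `TwoAxesTrivial` and (O3) `TwoLocalAxesRigidity` — PROVED

**(O2)** A `C¹` divergence-free field on `ℝ³` that is axisymmetric about the `e_z`-axis AND about a second axis through the
origin (`x ↦ R⁻¹ V (R x)` axisymmetric for a linear isometry `R` with `R e_z ∦ e_z`) vanishes identically.  **(O3)** Hence a
real-analytic divergence-free field that is LOCALLY axisymmetric about two distinct axes through `0` (on nonempty open sets)
vanishes — the NS flow admits no «silent pieces» (sketch `Cruxes/PoloidalLiouville/SilentShellsSketch.lean` v1.1, l.449 / l.457,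
bodies verbatim).

Proof of (O2), without Lie-group generation and without mollification.  Differentiating the two equivariances gives the
infinitesimal identities `DV(x)[e_z × x] = e_z × V(x)` (`IsAxisymmetric.fderiv_rotGen`) and, after transporting the identity of
the conjugate field back (`TwoAxes.fderiv_conj_generator`), `DV(x)[G x] = G (V x)` for `G = R ∘ J ∘ R⁻¹`, a skew map killing
`b = R e_z`; skew maps of `ℝ³` are cross products (`TwoAxes.exists_cross_of_skew`), so `G = w × ·` with `w ∥ b`, `w` not axial.
Conjugating by the rotations `R_θ` (which preserve `V`) turns `w` into `R_θ w`; `e_z`, `w`, `R_{π/2} w` span `ℝ³`, and the identity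
is linear in the axial vector, so `DV(x)[n × x] = n × V(x)` for EVERY `n`.  Taking `n = x`: `x × V(x) = 0`, i.e. `V = f · x` off
the origin; the identity then says `Df(x)[n × x] = 0` — `f` has no tangential derivative — so `f` is constant on spheres
(`R_θ`-invariance plus a zero derivative along the meridians, reached through `PrecessingHorizon.exists_rotZ_meridian_eq`).
With `g(r) = f(r e_z)`, `div V = Df(x)[x] + 3f = 0` gives `(r³ g)' = 0`, so `V = C x/‖x‖³` off `0`; continuity at the origin
(`r² V(r e_z) = C e_z → 0`) forces `C = 0`, whence `V ≡ 0`.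

BOOKING: information-grade structure lemma of the silent-shells card (why multi-axis steady constructions need SILENT blocks;
NS slices have none); below W1; NS regularity is NOT proved by any of this.
-/

-- the summit and its single problem share the name (D-0017 nested layout)
set_option linter.dupNamespace false

noncomputable section

namespace Summit.NavierStokesRegularity.NavierStokesRegularity.Theorems.PoloidalLiouville.SilentShells

open Set Function Filter Topology Metric
open scoped Topology RealInnerProductSpace
open Literature.Analysis.FluidPDE
open Summit.NavierStokesRegularity.NavierStokesRegularity.Theorems.PoloidalLiouville.HorizonTower (E3)
open Summit.NavierStokesRegularity.NavierStokesRegularity.Theorems.PoloidalLiouville.Precession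
  (PrecessingHorizon.meridian PrecessingHorizon.exists_rotZ_meridian_eq)

namespace TwoAxes

/-- **Step 1 — all infinitesimal rotations.**  Under the two equivariances, `DV(x)[n × x] = n × V(x)` for every axial vector `n`. -/
theorem fderiv_cross_all {V : E3 → E3} (R : E3 ≃ₗᵢ[ℝ] E3) (hVd : Differentiable ℝ V) (h₁ : IsAxisymmetric V)
    (h₂ : IsAxisymmetric (fun x => R.symm (V (R x)))) (hR : ∀ c : ℝ, R eZ ≠ c • eZ) :
    ∀ n x : E3, fderiv ℝ V x (cross n x) = cross n (V x) := by
  -- (a) the axis `e_z`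
  have hPz : ∀ x, fderiv ℝ V x (cross eZ x) = cross eZ (V x) := fun x => by
    rw [← rotGen_eq_cross, ← rotGen_eq_cross]; exact h₁.fderiv_rotGen (hVd x)
  -- (b) the conjugated generator `R ∘ J ∘ R⁻¹`
  have hWd : Differentiable ℝ (fun y => R.symm (V (R y))) := fun y =>
    (hasFDerivAt_conj R (hVd _)).differentiableAt
  have hGW : ∀ y, fderiv ℝ (fun y => R.symm (V (R y))) y (rotGen y) = rotGen (R.symm (V (R y))) :=
    fun y => h₂.fderiv_rotGen (hWd y)
  have hG2 : ∀ x, fderiv ℝ V x (R (rotGen (R.symm x))) = R (rotGen (R.symm (V x))) :=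
    fderiv_conj_generator R hVd (G := rotGen) hGW
  set Gb : E3 →L[ℝ] E3 :=
    (R.toContinuousLinearEquiv : E3 →L[ℝ] E3).comp
      (rotGenL.comp (R.symm.toContinuousLinearEquiv : E3 →L[ℝ] E3)) with hGbdef
  have hGb : ∀ x, Gb x = R (rotGen (R.symm x)) := fun x => by simp [hGbdef]
  have hskew : ∀ x y, ⟪Gb x, y⟫ = -⟪x, Gb y⟫ := by
    intro x y
    rw [hGb, hGb]
    have e1 : ⟪R (rotGen (R.symm x)), y⟫ = ⟪rotGen (R.symm x), R.symm y⟫ := by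
      conv_lhs => rw [← R.apply_symm_apply y]
      exact R.inner_map_map _ _
    have e2 : ⟪x, R (rotGen (R.symm y))⟫ = ⟪R.symm x, rotGen (R.symm y)⟫ := by
      conv_lhs => rw [← R.apply_symm_apply x]
      exact R.inner_map_map _ _
    rw [e1, e2, inner_rotGen_skew]
  obtain ⟨w, hw⟩ := exists_cross_of_skew Gb hskew
  have hPw : ∀ x, fderiv ℝ V x (cross w x) = cross w (V x) := fun x => by
    rw [← hw, ← hw, hGb, hGb]; exact hG2 x
  -- `w` is a nonzero multiple of `b = R e_z`, hence not axial
  have hb : R eZ ≠ 0 := fun h => hR 0 (by rw [h, zero_smul])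
  have hwb : cross w (R eZ) = 0 := by
    rw [← hw, hGb, R.symm_apply_apply]
    have h0 : rotGen (eZ : E3) = 0 := rotGen_single_two
    rw [h0, map_zero]
  obtain ⟨μ, hμ⟩ := Precession.ConicalEuler.exists_eq_smul_of_cross_eq_zero hb hwb
  have hw0 : w ≠ 0 := by
    intro h0
    have hz0 : ∀ y : E3, cross (0 : E3) y = 0 := fun y => by
      ext i; fin_cases i <;> simp [cross, crossProduct]
    have h1 : Gb (R (EuclideanSpace.single 0 (1 : ℝ))) = 0 := by rw [hw, h0, hz0]
    rw [hGb, R.symm_apply_apply, rotGen_single_zero] at h1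
    have h2 := congrArg norm h1
    rw [R.norm_map, norm_zero, PiLp.norm_single, norm_one] at h2
    exact one_ne_zero h2
  have hμ0 : μ ≠ 0 := by
    rintro rfl; exact hw0 (by rw [hμ, zero_smul])
  have hne : w 0 ^ 2 + w 1 ^ 2 ≠ 0 := by
    intro h0
    have h00 : w 0 = 0 := by nlinarith [sq_nonneg (w 0), sq_nonneg (w 1)]
    have h11 : w 1 = 0 := by nlinarith [sq_nonneg (w 0), sq_nonneg (w 1)]
    have hwz : w = (w 2) • (eZ : E3) := by
      ext i; fin_cases i <;> simp [eZ, h00, h11]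
    apply hR (μ⁻¹ * w 2)
    calc R eZ = μ⁻¹ • w := by rw [hμ, smul_smul, inv_mul_cancel₀ hμ0, one_smul]
      _ = (μ⁻¹ * w 2) • eZ := by
          conv_lhs => rw [hwz]
          rw [smul_smul]
  -- (c) conjugating by `R_θ` (which preserves `V`) rotates the axial vector
  have hrot : ∀ (θ : ℝ) (n : E3), (∀ x, fderiv ℝ V x (cross n x) = cross n (V x)) →
      ∀ x, fderiv ℝ V x (cross (rotZ θ n) x) = cross (rotZ θ n) (V x) := by
    intro θ n hn x
    have hconj : (fun y => (rotZLIE θ).symm (V ((rotZLIE θ) y))) = V := by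
      funext y
      simp only [rotZLIE_apply, rotZLIE_symm_apply]
      rw [h₁ θ y, ← rotZ_add, neg_add_cancel, rotZ_zero]
    have h := fderiv_conj_generator (rotZLIE θ) hVd (G := fun y => cross n y) (by
      intro y
      rw [hconj]
      simp only [rotZLIE_apply, rotZLIE_symm_apply]
      rw [h₁ θ y, ← rotZ_add, neg_add_cancel, rotZ_zero]
      exact hn y) x
    simp only [rotZLIE_apply, rotZLIE_symm_apply] at h
    have hback : ∀ y : E3, rotZ θ (rotZ (-θ) y) = y := fun y => by rw [← rotZ_add, add_neg_cancel, rotZ_zero]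
    rw [rotZ_cross, rotZ_cross, hback, hback] at h
    exact h
  -- (d) linearity in the axial vector
  have hlin : ∀ (a b : ℝ) (u v : E3), (∀ x, fderiv ℝ V x (cross u x) = cross u (V x)) →
      (∀ x, fderiv ℝ V x (cross v x) = cross v (V x)) →
      ∀ x, fderiv ℝ V x (cross (a • u + b • v) x) = cross (a • u + b • v) (V x) := by
    intro a b u v hu hv x
    have hcl : ∀ y : E3, cross (a • u + b • v) y = a • cross u y + b • cross v y := fun y => by
      ext i; fin_cases i <;> simp [cross, crossProduct]
    rw [hcl, hcl, map_add, map_smul, map_smul, hu x, hv x]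
  -- (e) span
  exact forall_of_span (P := fun n => ∀ x, fderiv ℝ V x (cross n x) = cross n (V x)) hlin hPz hPw (hrot _ _ hPw) hne

/-- **Step 2 — radial form.**  If `DV(x)[n × x] = n × V(x)` for all `n`, then `V(x) = f(x) x` off the origin with
`f(x) = ⟪V x, x⟫/‖x‖²`. -/
theorem eq_smul_of_fderiv_cross {V : E3 → E3} (hall : ∀ n x : E3, fderiv ℝ V x (cross n x) = cross n (V x))
    {x : E3} (hx : x ≠ 0) : V x = (⟪V x, x⟫ / ‖x‖ ^ 2) • x := by
  have h := hall x x
  have hxs : cross x x = 0 := by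
    ext i; fin_cases i <;> simp [cross, crossProduct] <;> ring
  rw [hxs, map_zero] at h
  have h' : cross (V x) x = 0 := by
    have hac : cross (V x) x = -cross x (V x) := by
      ext i; fin_cases i <;> simp [cross, crossProduct] <;> ring
    rw [hac, ← h, neg_zero]
  obtain ⟨μ, hμ⟩ := Precession.ConicalEuler.exists_eq_smul_of_cross_eq_zero hx h'
  have hxx : (0 : ℝ) < ‖x‖ ^ 2 := by positivity
  rw [hμ, real_inner_smul_left, real_inner_self_eq_norm_sq, mul_div_assoc, div_self hxx.ne', mul_one]

/-- The radial coefficient `f(x) = ⟪V x, x⟫/‖x‖²` is differentiable off the origin. -/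
theorem differentiableAt_rad {V : E3 → E3} (hVd : Differentiable ℝ V) {x : E3} (hx : x ≠ 0) :
    DifferentiableAt ℝ (fun y : E3 => ⟪V y, y⟫ / ‖y‖ ^ 2) x := by
  have hxx : ‖x‖ ^ 2 ≠ 0 := by positivity
  have h1 : DifferentiableAt ℝ (fun y : E3 => ⟪V y, y⟫) x := (hVd x).inner ℝ differentiableAt_id
  have h2 : DifferentiableAt ℝ (fun y : E3 => (‖y‖ ^ 2)⁻¹) x := (differentiableAt_id.norm_sq ℝ).inv hxx
  have h : DifferentiableAt ℝ (fun y : E3 => ⟪V y, y⟫ * (‖y‖ ^ 2)⁻¹) x := h1.mul h2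
  simpa only [div_eq_mul_inv] using h

/-- **Step 3 — no tangential derivative.**  `Df(x)[n × x] = 0` for `x ≠ 0` and every `n`. -/
theorem fderiv_rad_cross {V : E3 → E3} (hVd : Differentiable ℝ V)
    (hall : ∀ n x : E3, fderiv ℝ V x (cross n x) = cross n (V x)) {x : E3} (hx : x ≠ 0) (n : E3) :
    fderiv ℝ (fun y : E3 => ⟪V y, y⟫ / ‖y‖ ^ 2) x (cross n x) = 0 := by
  set f : E3 → ℝ := fun y => ⟪V y, y⟫ / ‖y‖ ^ 2 with hf
  have hfd : DifferentiableAt ℝ f x := differentiableAt_rad hVd hx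
  have hev : V =ᶠ[𝓝 x] fun y => f y • y := by
    filter_upwards [isOpen_compl_singleton.mem_nhds hx] with y hy
    exact eq_smul_of_fderiv_cross hall hy
  have hD : fderiv ℝ V x = f x • ContinuousLinearMap.id ℝ E3 + (fderiv ℝ f x).smulRight x := by
    rw [hev.fderiv_eq]; exact (hfd.hasFDerivAt.smul (hasFDerivAt_id x)).fderiv
  have hVx : V x = f x • x := eq_smul_of_fderiv_cross hall hx
  have hcs : cross n (f x • x) = f x • cross n x := by
    ext i; fin_cases i <;> simp [cross, crossProduct]
  have h := hall n x
  rw [hD, hVx, hcs] at h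
  simp only [add_apply, smul_apply, ContinuousLinearMap.id_apply, ContinuousLinearMap.smulRight_apply] at h
  have ht : (fderiv ℝ f x (cross n x)) • x = 0 := add_eq_left.mp h
  exact (smul_eq_zero.mp ht).resolve_right hx

/-- **Step 4a — invariance of `f` under rotations about the axis.** -/
theorem rad_rotZ {V : E3 → E3} (h₁ : IsAxisymmetric V) (θ : ℝ) (x : E3) :
    (fun y : E3 => ⟪V y, y⟫ / ‖y‖ ^ 2) (rotZ θ x) = (fun y : E3 => ⟪V y, y⟫ / ‖y‖ ^ 2) x := by
  have hi : ⟪rotZ θ (V x), rotZ θ x⟫ = ⟪V x, x⟫ := by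
    simpa using (rotZLIE θ).inner_map_map (V x) x
  simp only [h₁ θ x, hi, norm_rotZ]

/-- **Step 4b — `f` is constant along the meridians** `s ↦ (r sin s) e₀ + (r cos s) e_z` (`r > 0`). -/
theorem rad_meridian {V : E3 → E3} (hVd : Differentiable ℝ V)
    (hall : ∀ n x : E3, fderiv ℝ V x (cross n x) = cross n (V x)) {r : ℝ} (hr : 0 < r) (s : ℝ) :
    (fun y : E3 => ⟪V y, y⟫ / ‖y‖ ^ 2)
        ((r * Real.sin s) • EuclideanSpace.single 0 (1 : ℝ) + (r * Real.cos s) • (eZ : E3))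
      = (fun y : E3 => ⟪V y, y⟫ / ‖y‖ ^ 2) (r • eZ) := by
  set f : E3 → ℝ := fun y => ⟪V y, y⟫ / ‖y‖ ^ 2 with hf
  set p : ℝ → E3 := fun s => (r * Real.sin s) • EuclideanSpace.single 0 (1 : ℝ) + (r * Real.cos s) • (eZ : E3) with hp
  have hp0 : ∀ s, p s ≠ 0 := by
    intro s h0
    have h2 : p s 2 = 0 := by rw [h0]; rfl
    have h0' : p s 0 = 0 := by rw [h0]; rfl
    simp [hp, eZ] at h2 h0'
    rcases h0' with h | h
    · exact absurd h hr.ne'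
    · rcases h2 with h' | h'
      · exact absurd h' hr.ne'
      · nlinarith [Real.sin_sq_add_cos_sq s]
  have hpd : ∀ s, HasDerivAt p ((r * Real.cos s) • EuclideanSpace.single 0 (1 : ℝ) + (-(r * Real.sin s)) • (eZ : E3)) s := by
    intro s
    have h1 : HasDerivAt (fun s => r * Real.sin s) (r * Real.cos s) s := (Real.hasDerivAt_sin s).const_mul r
    have h2 : HasDerivAt (fun s => r * Real.cos s) (-(r * Real.sin s)) s := by
      have := (Real.hasDerivAt_cos s).const_mul r; simpa [mul_neg] using this
    exact (h1.smul_const _).add (h2.smul_const _)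
  -- the velocity of the meridian is the infinitesimal rotation about `e₁`
  have hvel : ∀ s, (r * Real.cos s) • EuclideanSpace.single 0 (1 : ℝ) + (-(r * Real.sin s)) • (eZ : E3)
      = cross (EuclideanSpace.single 1 (1 : ℝ)) (p s) := by
    intro s; ext i; fin_cases i <;> simp [hp, eZ, cross, crossProduct]
  have hφ : ∀ s, HasDerivAt (fun s => f (p s)) 0 s := by
    intro s
    have hfd : DifferentiableAt ℝ f (p s) := differentiableAt_rad hVd (hp0 s)
    have h := hfd.hasFDerivAt.comp_hasDerivAt s (hpd s)
    rw [hvel s, fderiv_rad_cross hVd hall (hp0 s)] at h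
    exact h
  have hconst := is_const_of_deriv_eq_zero (f := fun s => f (p s)) (fun s => (hφ s).differentiableAt)
    (fun s => (hφ s).deriv) s 0
  have hp00 : p 0 = r • eZ := by simp [hp]
  simpa [hp00] using hconst

/-- **Step 4c — `f` is constant on spheres**: `f(x) = f(‖x‖ e_z)` for `x ≠ 0`. -/
theorem rad_eq_rad_axis {V : E3 → E3} (hVd : Differentiable ℝ V) (h₁ : IsAxisymmetric V)
    (hall : ∀ n x : E3, fderiv ℝ V x (cross n x) = cross n (V x)) {x : E3} (hx : x ≠ 0) :
    (fun y : E3 => ⟪V y, y⟫ / ‖y‖ ^ 2) x = (fun y : E3 => ⟪V y, y⟫ / ‖y‖ ^ 2) (‖x‖ • eZ) := by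
  set f : E3 → ℝ := fun y => ⟪V y, y⟫ / ‖y‖ ^ 2 with hf
  have hr : 0 < ‖x‖ := norm_pos_iff.mpr hx
  set u : E3 := ‖x‖⁻¹ • x with hu
  have hun : ‖u‖ = 1 := by rw [hu, norm_smul, norm_inv, norm_norm, inv_mul_cancel₀ hr.ne']
  obtain ⟨θ, hθ⟩ := PrecessingHorizon.exists_rotZ_meridian_eq hun
  have hxu : x = ‖x‖ • u := by rw [hu, smul_smul, mul_inv_cancel₀ hr.ne', one_smul]
  -- the meridian point, rescaled, is on the meridian curve of radius `‖x‖` at parameter `arccos (u 2)`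
  have hu2 : -1 ≤ u 2 ∧ u 2 ≤ 1 := by
    have hsq : u 0 ^ 2 + u 1 ^ 2 + u 2 ^ 2 = 1 := by
      have h := hun
      rw [EuclideanSpace.norm_eq, Real.sqrt_eq_one, Fin.sum_univ_three] at h
      simpa only [Real.norm_eq_abs, sq_abs] using h
    constructor <;> nlinarith [sq_nonneg (u 0), sq_nonneg (u 1)]
  have hmer : ‖x‖ • PrecessingHorizon.meridian (u 2)
      = (‖x‖ * Real.sin (Real.arccos (u 2))) • EuclideanSpace.single 0 (1 : ℝ)
        + (‖x‖ * Real.cos (Real.arccos (u 2))) • (eZ : E3) := by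
    rw [Real.sin_arccos, Real.cos_arccos hu2.1 hu2.2]
    ext i; fin_cases i <;> simp [PrecessingHorizon.meridian, eZ]
  have hsm : rotZ θ (‖x‖ • PrecessingHorizon.meridian (u 2)) = ‖x‖ • rotZ θ (PrecessingHorizon.meridian (u 2)) :=
    (rotZLIE θ).map_smul ‖x‖ (PrecessingHorizon.meridian (u 2))
  calc f x = f (rotZ θ (‖x‖ • PrecessingHorizon.meridian (u 2))) := by
        rw [hsm, hθ, ← hxu]
    _ = f (‖x‖ • PrecessingHorizon.meridian (u 2)) := rad_rotZ h₁ θ _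
    _ = f (‖x‖ • eZ) := by rw [hmer]; exact rad_meridian hVd hall hr _

end TwoAxes

open TwoAxes in
/-- **(O2) `TwoAxesTrivial`** (silent-shells sketch l.449, body verbatim): a `C¹` divergence-free field axisymmetric about the
`e_z`-axis and about a second, distinct axis through `0` vanishes identically. -/
theorem twoAxesTrivial :
    ∀ (V : E3 → E3) (R : E3 ≃ₗᵢ[ℝ] E3), ContDiff ℝ 1 V → VectorCalculus.IsDivFree V →
      IsAxisymmetric V → IsAxisymmetric (fun x => R.symm (V (R x))) →
      (∀ c : ℝ, R eZ ≠ c • eZ) → V = 0 := by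
  intro V R hV hdiv h₁ h₂ hR
  have hVd : Differentiable ℝ V := hV.differentiable one_ne_zero
  have hall := fderiv_cross_all R hVd h₁ h₂ hR
  set f : E3 → ℝ := fun y => ⟪V y, y⟫ / ‖y‖ ^ 2 with hf
  have hVf : ∀ x : E3, x ≠ 0 → V x = f x • x := fun x hx => eq_smul_of_fderiv_cross hall hx
  have hfax : ∀ x : E3, x ≠ 0 → f x = f (‖x‖ • eZ) := fun x hx => rad_eq_rad_axis hVd h₁ hall hx
  have heZ : (eZ : E3) ≠ 0 := by
    intro h
    have h2 := congrArg (fun v : E3 => v 2) h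
    simp [eZ] at h2
  have hne : ∀ r : ℝ, 0 < r → r • (eZ : E3) ≠ 0 := fun r hr => smul_ne_zero hr.ne' heZ
  -- `div V = 0` in radial form: `Df(x)[x] + 3 f(x) = 0` off the origin
  have hdivx : ∀ x : E3, x ≠ 0 → fderiv ℝ f x x + 3 * f x = 0 := by
    intro x hx
    have hev : V =ᶠ[𝓝 x] fun y => f y • y := by
      filter_upwards [isOpen_compl_singleton.mem_nhds hx] with y hy using hVf y hy
    have h0 := hdiv x
    unfold VectorCalculus.divergence at h0
    rw [hev.fderiv_eq] at h0
    have h1 := divergence_smul_id (differentiableAt_rad hVd hx)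
    unfold VectorCalculus.divergence at h1
    rw [h1] at h0
    exact h0
  -- the radial ODE: `r³ f(r e_z)` has zero derivative on `(0, ∞)`
  have hH : ∀ r ∈ Ioi (0 : ℝ), HasDerivAt (fun r : ℝ => r ^ 3 * f (r • eZ)) 0 r := by
    intro r hr
    have hr' : 0 < r := hr
    have hfd : DifferentiableAt ℝ f (r • eZ) := differentiableAt_rad hVd (hne r hr')
    have hp : HasDerivAt (fun r : ℝ => r • (eZ : E3)) eZ r := by
      simpa using (hasDerivAt_id r).smul_const (eZ : E3)
    have hcomp : HasDerivAt (fun r : ℝ => f (r • eZ)) (fderiv ℝ f (r • eZ) eZ) r := by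
      have h := hfd.hasFDerivAt.comp_hasDerivAt r hp
      simpa [Function.comp_def] using h
    have h3 : HasDerivAt (fun r : ℝ => r ^ 3) (3 * r ^ 2) r := by
      simpa using hasDerivAt_pow 3 r
    have h := h3.mul hcomp
    have hd := hdivx (r • eZ) (hne r hr')
    rw [map_smul, smul_eq_mul] at hd
    refine h.congr_deriv ?_
    linear_combination (r ^ 2) * hd
  have hconst : ∀ r ∈ Ioi (0 : ℝ), ∀ r' ∈ Ioi (0 : ℝ), r ^ 3 * f (r • eZ) = r' ^ 3 * f (r' • eZ) :=
    fun r hr r' hr' => isOpen_Ioi.is_const_of_deriv_eq_zero (convex_Ioi 0).isPreconnected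
      (fun r hr => (hH r hr).differentiableAt.differentiableWithinAt) (fun r hr => (hH r hr).deriv) hr hr'
  -- the constant vanishes: `r² V(r e_z) = C e_z → 0` as `r → 0⁺`
  set C : ℝ := f ((1 : ℝ) • eZ) with hC
  have hVr : ∀ r : ℝ, 0 < r → r ^ 2 • V (r • eZ) = C • (eZ : E3) := by
    intro r hr
    rw [hVf _ (hne r hr), smul_smul, smul_smul]
    congr 1
    have h := hconst r hr 1 (Set.mem_Ioi.mpr one_pos)
    rw [one_pow, one_mul] at h
    calc r ^ 2 * f (r • eZ) * r = r ^ 3 * f (r • eZ) := by ring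
      _ = C := h
  have hcont : Continuous fun r : ℝ => V (r • (eZ : E3)) := hV.continuous.comp (continuous_id.smul continuous_const)
  have hC0 : C = 0 := by
    have hlim : Tendsto (fun r : ℝ => r ^ 2 • V (r • eZ)) (𝓝[>] 0) (𝓝 0) := by
      have hc : Continuous fun r : ℝ => r ^ 2 • V (r • (eZ : E3)) := (continuous_pow 2).smul hcont
      have h := hc.tendsto 0
      simp only [zero_pow two_ne_zero, zero_smul] at h
      exact h.mono_left nhdsWithin_le_nhds
    have hlim' : Tendsto (fun r : ℝ => r ^ 2 • V (r • eZ)) (𝓝[>] 0) (𝓝 (C • (eZ : E3))) :=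
      tendsto_const_nhds.congr' (by
        filter_upwards [self_mem_nhdsWithin] with r hr using (hVr r hr).symm)
    have hCe : C • (eZ : E3) = 0 := tendsto_nhds_unique hlim' hlim
    exact (smul_eq_zero.mp hCe).resolve_right heZ
  have hfr : ∀ r : ℝ, 0 < r → f (r • eZ) = 0 := by
    intro r hr
    have h := hconst r hr 1 (Set.mem_Ioi.mpr one_pos)
    rw [one_pow, one_mul, ← hC, hC0] at h
    exact (mul_eq_zero.mp h).resolve_left (pow_ne_zero 3 hr.ne')
  have hV0 : ∀ x : E3, x ≠ 0 → V x = 0 := fun x hx => by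
    rw [hVf x hx, hfax x hx, hfr ‖x‖ (norm_pos_iff.mpr hx), zero_smul]
  have hV00 : V 0 = 0 := by
    have hlim : Tendsto (fun r : ℝ => V (r • eZ)) (𝓝[>] 0) (𝓝 (V 0)) := by
      have h := hcont.tendsto 0
      simp only [zero_smul] at h
      exact h.mono_left nhdsWithin_le_nhds
    have hlim0 : Tendsto (fun r : ℝ => V (r • (eZ : E3))) (𝓝[>] 0) (𝓝 0) :=
      tendsto_const_nhds.congr' (by
        filter_upwards [self_mem_nhdsWithin] with r hr using (hV0 _ (hne r hr)).symm)
    exact tendsto_nhds_unique hlim hlim0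
  funext x
  by_cases hx : x = 0
  · rw [hx]; exact hV00
  · exact hV0 x hx

/-- **(O3) `TwoLocalAxesRigidity`** (silent-shells sketch l.457, body verbatim): a real-analytic divergence-free field on `ℝ³`
that is locally axisymmetric about two distinct axes through `0` on nonempty open sets vanishes identically — the sketch's glue
`twoLocalAxesRigidity_of_twoAxesTrivial` composed with (O2). -/
theorem twoLocalAxesRigidity :
    ∀ (V : E3 → E3) (R : E3 ≃ₗᵢ[ℝ] E3) (S₁ S₂ : Set E3), AnalyticOnNhd ℝ V univ →
      VectorCalculus.IsDivFree V → IsOpen S₁ → S₁.Nonempty → IsOpen S₂ → S₂.Nonempty →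
      (∀ θ : ℝ, ∀ x ∈ S₁, V (rotZ θ x) = rotZ θ (V x)) →
      (∀ θ : ℝ, ∀ x ∈ S₂, R.symm (V (R (rotZ θ x))) = rotZ θ (R.symm (V (R x)))) →
      (∀ c : ℝ, R eZ ≠ c • eZ) → V = 0 := by
  intro V R S₁ S₂ hV hdiv hS₁ hne₁ hS₂ hne₂ hl₁ hl₂ hR
  have hax₁ : IsAxisymmetric V := isAxisymmetric_of_locallyAxisymmetric hV hS₁ hne₁ hl₁
  have hW : AnalyticOnNhd ℝ (fun x => R.symm (V (R x))) univ := by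
    have e : (fun x => R.symm (V (R x))) =
        (R.symm.toLinearIsometry.toContinuousLinearMap) ∘ V ∘ (R.toLinearIsometry.toContinuousLinearMap) := by
      ext x; simp
    rw [e]
    refine (ContinuousLinearMap.analyticOnNhd _ _).comp (hV.comp
      (ContinuousLinearMap.analyticOnNhd _ _) (mapsTo_univ _ _)) (mapsTo_univ _ _)
  have hax₂ : IsAxisymmetric (fun x => R.symm (V (R x))) :=
    isAxisymmetric_of_locallyAxisymmetric hW hS₂ hne₂ hl₂
  exact twoAxesTrivial V R hV.contDiff hdiv hax₁ hax₂ hR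

end Summit.NavierStokesRegularity.NavierStokesRegularity.Theorems.PoloidalLiouville.SilentShells

end
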